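import Summits.FinalStateConjecture.FinalStateConjecture.Theorems.EIHFluxBalanceInertialRecessionStubEndgameOracleMixedIncrement
import Summits.FinalStateConjecture.FinalStateConjecture.Theorems.EIHFluxBalanceInertialRecessionStubEndgameOracleTightUniv
import Summits.FinalStateConjecture.FinalStateConjecture.Theorems.EIHFluxBalanceInertialRecessionStubEndgameVelocityLimits

/-!
# Route EIHFluxBalance — crux `InertialRecession`, line `sublinear-is-free-clean-window-charges`:
# the increment oracle for a slow system without outsiders — preparations (scale-`t` ratios, bands, classes)

Helper file for the crux `stmt-FinalStateConjecture-10166`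
(`Summit.FinalStateConjecture.FinalStateConjecture.Theses.EIHFluxBalance.InertialRecession`), registered stub `stub_incrementOracle`
(lead reshape r9/r10) of `Cruxes/InertialRecession/Lines/sublinear_is_free_clean_window_charges.lean`.

For an internally slow system (`|d/ds ‖ξₖ − ξₗ‖| ≤ σ`) the scale-`t` RATIOS `r_kl(s) = ‖ξₖ(s) − ξₗ(s)‖/(c₀s)` cannot cross a level
`e ≥ σ/c₀` upwards (`ratio_lt_of_lt`); a pigeonhole EMPTY BAND `[λ, 16λ)` of the ratios at a time `u` (`exists_emptyBand`, landed)
makes "`r < λ`" an equivalence relation whose classes have scale-`t` diameter `< λ` while different classes are `≥ 16λ` apart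
(`ratioClasses`); the classes partition the index set, so cluster sums split (`sum_eq_sum_classes`) and the total increment is at
most the number of classes times the worst class increment (`abs_sub_sum_classes_le`). These feed the band iteration of
`…OracleUnivBands`.
-/

noncomputable section

set_option linter.dupNamespace false

open Filter Topology Set MeasureTheory intervalIntegral
open scoped Topology BigOperators

namespace Summit.FinalStateConjecture.FinalStateConjecture.Theorems.SublinearIsFree.Oracle

open Literature.Geometry.Lorentzian
open Summit.FinalStateConjecture.FinalStateConjecture.Theorems.SublinearIsFree.Endgame

/-! ### Scale-`t` ratios of a slow system do not cross levels upwards -/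

/-- NO UP-CROSSING: if `|d(s₁) − d(s₀)| ≤ σ(s₁ − s₀)` for `s₀ ≤ s₁`, `c₀e ≥ σ`, `0 < c₀`, and `d(s₀) < e·c₀s₀`, then `d(s₁) < e·c₀s₁`.
[folklore] -/
theorem dist_lt_level_of_lt {d : ℝ → ℝ} {σ c₀ e s₀ s₁ : ℝ} (hσe : σ ≤ c₀ * e)
    (hslow : |d s₁ - d s₀| ≤ σ * (s₁ - s₀)) (h01 : s₀ ≤ s₁) (h0 : d s₀ < e * (c₀ * s₀)) :
    d s₁ < e * (c₀ * s₁) := by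
  have h1 : d s₁ - d s₀ ≤ σ * (s₁ - s₀) := (le_abs_self _).trans hslow
  have h2 : σ * (s₁ - s₀) ≤ c₀ * e * (s₁ - s₀) := mul_le_mul_of_nonneg_right hσe (by linarith)
  nlinarith

/-- The scale-`t` ratio `‖ξₖ(s) − ξₗ(s)‖/(c₀s)` is continuous on `(0, ∞)`-intervals. [folklore] -/
theorem continuousOn_ratio {ξk ξl : ℝ → E3} (hk : Continuous ξk) (hl : Continuous ξl) {c₀ t₁ t₂ : ℝ} (hc₀ : 0 < c₀)
    (ht₁ : 0 < t₁) : ContinuousOn (fun s ↦ ‖ξk s - ξl s‖ / (c₀ * s)) (Icc t₁ t₂) := by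
  refine ((hk.sub hl).norm.continuousOn).div (continuousOn_const.mul continuousOn_id) fun s hs ↦ ?_
  exact (mul_pos hc₀ (ht₁.trans_le hs.1)).ne'

/-! ### Classes of an empty band -/

/-- **CLASSES OF AN EMPTY BAND.** If the pairwise ratios `w k l = w l k ≥ 0`, `w k k = 0`, `w k j ≤ w k l + w l j` avoid the band
`[λ′, 16λ′)` (`λ′ > 0`), then `k ~ l :⇔ w k l < λ′` is an equivalence relation; its classes `cls k = {l | w k l < λ′}` satisfy:
`k ∈ cls k`, members of one class are pairwise `< λ′`, members of different classes are `≥ 16λ′` apart, and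
`l ∈ cls k ↔ cls l = cls k`. [folklore] -/
theorem ratioClasses {N : ℕ} (w : Fin N → Fin N → ℝ) {lam : ℝ} (hlam : 0 < lam)
    (hdiag : ∀ k, w k k = 0) (hsymm : ∀ k l, w k l = w l k) (htri : ∀ k l j, w k j ≤ w k l + w l j)
    (hband : ∀ k l, ¬ (lam ≤ w k l ∧ w k l < 16 * lam)) :
    (∀ k, k ∈ Finset.univ.filter fun l ↦ w k l < lam) ∧
    (∀ k, ∀ i ∈ Finset.univ.filter (fun l ↦ w k l < lam), ∀ j ∈ Finset.univ.filter (fun l ↦ w k l < lam), w i j < lam) ∧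
    (∀ k, ∀ i ∈ Finset.univ.filter (fun l ↦ w k l < lam), ∀ j ∉ Finset.univ.filter (fun l ↦ w k l < lam), 16 * lam ≤ w i j) ∧
    (∀ k l, l ∈ Finset.univ.filter (fun l' ↦ w k l' < lam) ↔
      Finset.univ.filter (fun l' ↦ w l l' < lam) = Finset.univ.filter (fun l' ↦ w k l' < lam)) := by
  classical
  have hequiv := equivalence_of_emptyBand w (by norm_num : (2 : ℝ) ≤ 16) hlam hdiag hsymm htri hband
  have hmem : ∀ k l, l ∈ Finset.univ.filter (fun l' ↦ w k l' < lam) ↔ w k l < lam := fun k l ↦ by simp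
  refine ⟨fun k ↦ (hmem k k).mpr (hequiv.refl k), ?_, ?_, ?_⟩
  · intro k i hi j hj
    exact hequiv.trans (hequiv.symm ((hmem k i).mp hi)) ((hmem k j).mp hj)
  · intro k i hi j hj
    have hij : ¬ w i j < lam := fun h ↦ hj ((hmem k j).mpr (hequiv.trans ((hmem k i).mp hi) h))
    by_contra hlt
    push Not at hlt
    exact hband i j ⟨not_lt.mp hij, hlt⟩
  · intro k l
    constructor
    · intro hl
      have hkl : w k l < lam := (hmem k l).mp hl
      ext j
      simp only [Finset.mem_filter, Finset.mem_univ, true_and]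
      exact ⟨fun h ↦ hequiv.trans hkl h, fun h ↦ hequiv.trans (hequiv.symm hkl) h⟩
    · intro heq
      have : l ∈ Finset.univ.filter (fun l' ↦ w l l' < lam) := (hmem l l).mpr (hequiv.refl l)
      rwa [heq] at this

/-! ### Sums over the classes -/

/-- A sum over all indices is the sum over the classes of the class sums, for any class map `cls` with
`l ∈ cls k ↔ cls l = cls k`. [folklore] -/
theorem sum_eq_sum_classes {N : ℕ} (cls : Fin N → Finset (Fin N))
    (hcls : ∀ k l, l ∈ cls k ↔ cls l = cls k) (f : Fin N → ℝ) :
    ∑ i, f i = ∑ P ∈ Finset.univ.image cls, ∑ i ∈ P, f i := by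
  classical
  symm
  refine Finset.sum_image' f fun c _ ↦ ?_
  congr 1
  ext x
  simp only [Finset.mem_filter, Finset.mem_univ, true_and]
  exact hcls c x

/-- The total increment is at most the number of classes times the worst class increment. [folklore] -/
theorem abs_sub_sum_classes_le {N : ℕ} (cls : Fin N → Finset (Fin N))
    (hcls : ∀ k l, l ∈ cls k ↔ cls l = cls k) (f g : Fin N → ℝ) {X : ℝ}
    (hX : ∀ k, |∑ i ∈ cls k, f i - ∑ i ∈ cls k, g i| ≤ X) :
    |∑ i, f i - ∑ i, g i| ≤ N * X := by
  classical
  rcases Nat.eq_zero_or_pos N with hN | hN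
  · subst hN; simp
  have hX0 : 0 ≤ X := (abs_nonneg _).trans (hX ⟨0, hN⟩)
  rw [sum_eq_sum_classes cls hcls f, sum_eq_sum_classes cls hcls g, ← Finset.sum_sub_distrib]
  calc |∑ P ∈ Finset.univ.image cls, (∑ i ∈ P, f i - ∑ i ∈ P, g i)|
      ≤ ∑ P ∈ Finset.univ.image cls, |∑ i ∈ P, f i - ∑ i ∈ P, g i| := Finset.abs_sum_le_sum_abs _ _
    _ ≤ ∑ P ∈ Finset.univ.image cls, X := by
        refine Finset.sum_le_sum fun P hP ↦ ?_
        obtain ⟨k, -, rfl⟩ := Finset.mem_image.mp hP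
        exact hX k
    _ = (Finset.univ.image cls).card * X := by rw [Finset.sum_const, nsmul_eq_mul]
    _ ≤ N * X := by
        refine mul_le_mul_of_nonneg_right ?_ hX0
        have := Finset.card_image_le (s := (Finset.univ : Finset (Fin N))) (f := cls)
        rw [Finset.card_univ, Fintype.card_fin] at this
        exact_mod_cast this

/-- Registered helper form of `dist_lt_level_of_lt` (carrier of this file). [folklore] -/
theorem oracle_dist_lt_level_of_lt : ∀ (d : ℝ → ℝ) (σ c₀ e s₀ s₁ : ℝ), σ ≤ c₀ * e → |d s₁ - d s₀| ≤ σ * (s₁ - s₀) → s₀ ≤ s₁ → d s₀ < e * (c₀ * s₀) → d s₁ < e * (c₀ * s₁) :=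
  fun _ _ _ _ _ _ hσe hslow h01 h0 ↦ dist_lt_level_of_lt hσe hslow h01 h0

end Summit.FinalStateConjecture.FinalStateConjecture.Theorems.SublinearIsFree.Oracle

end
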